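import Mathlib.MeasureTheory.Integral.Gamma
import Literature.Analysis.FluidPDE.SawtoothCascadeProfileCurvature
import HarnessLib

/-!
# Higher derivatives of the rounded sawtooth: `|S_δ‴| ≤ 2/δ²`, `|S_δ⁗| ≤ 10/(δ³√(2π))`,
# `|S_δ⁽⁵⁾| ≤ 12/δ⁴`, and the cascade-profile caps `|U_j⁽ᵏ⁾| ≤ c_k (2πN_j)^{k−1}/δ_j^{k−1}`

Proofs-layer sequel of `SawtoothCascadeProfileCurvature.lean` (cell `ad-ideate`, route
SawtoothPulseCascade; theorems only, no definitions, no named facts). With `S_δ = tri ⋆ g_δ` and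
`S_δ′ = tri′ ⋆ g_δ` (`deriv_roundedSaw_eq`), every further derivative falls on the Gaussian:
`S_δ⁽ᵏ⁾ = tri′ ⋆ g_δ⁽ᵏ⁻¹⁾`, `|tri′| ≤ 1`, hence `‖S_δ⁽ᵏ⁾‖_∞ ≤ ‖g_δ⁽ᵏ⁻¹⁾‖_{L¹}` (Folland, Prop. 8.8 and
8.10). The `L¹` norms are bounded through the Gaussian moments `∫u²g_δ = δ²`, `∫|u|³g_δ = 4δ³/√(2π)`,
`∫u⁴g_δ = 3δ⁴`:

* `hasDerivAt_integral_deriv_tri_mul` — the abstract step: for a `C¹` kernel `K` with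
  `|K′(u)| ≤ (A + B|u|ⁿ) e^{−bu²}`, `θ ↦ ∫ tri′(s) K(θ − s) ds` is differentiable with derivative
  `∫ tri′(s) K′(θ − s) ds` (dominated differentiation on the unit ball around `θ`);
* `hasDerivAt_deriv2_roundedSaw`, `abs_deriv3_roundedSaw_le` — `S_δ‴ = tri′ ⋆ g_δ″`,
  `|S_δ‴| ≤ ∫ (u²/δ⁴ + 1/δ²) g_δ = 2/δ²`;
* `hasDerivAt_deriv3_roundedSaw`, `abs_deriv4_roundedSaw_le` — `|S_δ⁗| ≤ ∫ (3|u|/δ⁴ + |u|³/δ⁶) g_δ = 10/(δ³√(2π))`;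
* `hasDerivAt_deriv4_roundedSaw`, `abs_deriv5_roundedSaw_le` — `|S_δ⁽⁵⁾| ≤ ∫ (3/δ⁴ + 6u²/δ⁶ + u⁴/δ⁸) g_δ = 12/δ⁴`;
* `CascadeParams.abs_deriv3_U_le`, `abs_deriv4_U_le`, `abs_deriv5_U_le` — `U_j⁽ᵏ⁾(y) = (2πN_j)^{k−1} S⁽ᵏ⁾(2πN_j y)`,
  so `|U_j‴| ≤ 2(2πN_j)²/δ_j²`, `|U_j⁗| ≤ 10(2πN_j)³/(δ_j³√(2π))`, `|U_j⁽⁵⁾| ≤ 12(2πN_j)⁴/δ_j⁴`.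

Requested by the SawtoothPulseCascade line `lip-agmon` (caps `k = 3, 4, 5` for the source and
force terms of the linearised vorticity equation along the cascade carrier).

## Mathlib / tree search

Tree (reused): `hasDerivAt_deriv_roundedSaw`, `deriv_roundedSaw_eq`, `abs_deriv_tri_le_one`,
`hasDerivAt_gaussKernel`, `continuous_gaussKernel`, `integrable_gaussKernel`, `integral_gaussKernel`,
`integrable_abs_mul_gaussKernel`, `integral_abs_mul_gaussKernel`, `integral_Ioi_mul_exp_neg_mul_sq`,
`CascadeParams.hasDerivAt_deriv_U` (`SawtoothCascadeProfileCurvature`); Mathlib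
`hasDerivAt_integral_of_dominated_loc_of_deriv_le`, `integral_rpow_mul_exp_neg_mul_rpow`,
`integral_comp_abs`, `integrable_rpow_mul_exp_neg_mul_sq`. Searched `deriv3_roundedSaw`, `gaussKernel.*moment`: nothing.

## References

* G. B. Folland, *Real Analysis*, 2nd ed., Wiley 1999, §8.2 Props. 8.8, 8.10, Thm. 2.27, Prop. 2.53. [Folland1999]
* T. M. Elgindi, K. Liss, J. C. Mattingly, arXiv:2304.05374, §1 (the pulsed shear profiles). [ElgindiLissMattingly2025]
-/

noncomputable section

open MeasureTheory Set Filter Topology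
open scoped NNReal ENNReal

namespace Literature.Analysis.FluidPDE.SawtoothCascade

open Literature.Analysis Literature.Analysis.FunctionSpaces

/-! ### §1 Elementary inequalities -/

/-- `(a + 1)ⁿ ≤ 2ⁿ (aⁿ + 1)` for `a ≥ 0`. [folklore] -/
private theorem add_one_pow_le {a : ℝ} (ha : 0 ≤ a) (n : ℕ) : (a + 1) ^ n ≤ 2 ^ n * (a ^ n + 1) := by
  rcases le_total a 1 with h | h
  · calc (a + 1) ^ n ≤ 2 ^ n := pow_le_pow_left₀ (by linarith) (by linarith) n
      _ ≤ 2 ^ n * (a ^ n + 1) := by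
          have : 0 ≤ a ^ n := pow_nonneg ha n
          nlinarith [pow_nonneg (by norm_num : (0:ℝ) ≤ 2) n]
  · calc (a + 1) ^ n ≤ (2 * a) ^ n := pow_le_pow_left₀ (by linarith) (by linarith) n
      _ = 2 ^ n * a ^ n := by rw [mul_pow]
      _ ≤ 2 ^ n * (a ^ n + 1) := by
          have : 0 ≤ (2:ℝ) ^ n := pow_nonneg (by norm_num) n
          nlinarith

/-- `|u|ʲ ≤ 1 + |u|ⁿ` for `j ≤ n`. [folklore] -/
private theorem abs_pow_le_one_add_abs_pow (u : ℝ) {j n : ℕ} (hjn : j ≤ n) : |u| ^ j ≤ 1 + |u| ^ n := by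
  rcases le_total |u| 1 with h | h
  · have : |u| ^ j ≤ 1 := pow_le_one₀ (abs_nonneg u) h
    linarith [pow_nonneg (abs_nonneg u) n]
  · have : |u| ^ j ≤ |u| ^ n := pow_le_pow_right₀ h hjn
    linarith

/-! ### §2 Differentiating `θ ↦ ∫ tri′(s) K(θ − s) ds` under the integral -/

/-- **Dominated differentiation of `tri′ ⋆ K`.** Let `K` be `C¹` with `K`, `K′` continuous, `K`
integrable and `|K′(u)| ≤ (A + B|u|ⁿ) e^{−bu²}` (`A, B ≥ 0`, `b > 0`). Then
`θ ↦ ∫ tri′(s) K(θ − s) ds` is differentiable with derivative `∫ tri′(s) K′(θ − s) ds` (on the unit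
ball around `θ` the integrand's derivative is dominated by
`2ⁿ e^{b}(A + B(|s − θ|ⁿ + 1)) e^{−(b/2)(s−θ)²}`). [cite: Folland1999, §8.2 Prop. 8.10 with Thm. 2.27 (differentiating a convolution under the integral)] -/
theorem hasDerivAt_integral_deriv_tri_mul {K K' : ℝ → ℝ} (hK : ∀ u, HasDerivAt K (K' u) u)
    (hKc : Continuous K) (hK'c : Continuous K') (hKi : Integrable K) {A B b : ℝ} (hA : 0 ≤ A) (hB : 0 ≤ B)
    (hb : 0 < b) (n : ℕ) (hbd : ∀ u, |K' u| ≤ (A + B * |u| ^ n) * Real.exp (-b * u ^ 2)) (θ : ℝ) :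
    HasDerivAt (fun x => ∫ s, deriv tri s * K (x - s)) (∫ s, deriv tri s * K' (θ - s)) θ := by
  -- measurability and integrability of the integrand
  have hmeas : ∀ x : ℝ, AEStronglyMeasurable (fun s => deriv tri s * K (x - s)) volume := fun x =>
    ((measurable_deriv tri).mul (hKc.measurable.comp (measurable_const.sub measurable_id))).aestronglyMeasurable
  have hF_int : Integrable (fun s => deriv tri s * K (θ - s)) := by
    refine (hKi.comp_sub_left θ).bdd_mul (c := 1) (measurable_deriv tri).aestronglyMeasurable
      (ae_of_all _ fun s => ?_)
    rw [Real.norm_eq_abs]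
    exact abs_deriv_tri_le_one s
  have hF'_meas : AEStronglyMeasurable (fun s => deriv tri s * K' (θ - s)) volume :=
    ((measurable_deriv tri).mul (hK'c.measurable.comp (measurable_const.sub measurable_id))).aestronglyMeasurable
  -- the dominating function
  set M : ℝ → ℝ := fun s => Real.exp b * (A + B * (2 ^ n * (|s - θ| ^ n + 1))) *
    Real.exp (-(b / 2) * (s - θ) ^ 2) with hM
  have h_bound : ∀ᵐ s : ℝ, ∀ x ∈ Metric.ball θ 1, ‖deriv tri s * K' (x - s)‖ ≤ M s := by
    refine ae_of_all _ fun s x hx => ?_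
    rw [Metric.mem_ball, Real.dist_eq] at hx
    have he : (x - θ) ^ 2 ≤ 1 := by
      have h1 := abs_lt.1 hx
      nlinarith
    have hxs : (s - θ) ^ 2 / 2 - 1 ≤ (x - s) ^ 2 := by
      nlinarith [sq_nonneg ((θ - s) + 2 * (x - θ)), he]
    have hxabs : |x - s| ≤ |s - θ| + 1 := by
      calc |x - s| = |(x - θ) + (θ - s)| := by ring_nf
        _ ≤ |x - θ| + |θ - s| := abs_add_le _ _
        _ ≤ 1 + |s - θ| := by rw [abs_sub_comm θ s]; linarith
        _ = |s - θ| + 1 := by ring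
    have hpow : |x - s| ^ n ≤ 2 ^ n * (|s - θ| ^ n + 1) :=
      (pow_le_pow_left₀ (abs_nonneg _) hxabs n).trans (add_one_pow_le (abs_nonneg _) n)
    have hexp : Real.exp (-b * (x - s) ^ 2) ≤ Real.exp b * Real.exp (-(b / 2) * (s - θ) ^ 2) := by
      rw [← Real.exp_add]
      refine Real.exp_le_exp.2 ?_
      nlinarith [hxs, hb]
    rw [Real.norm_eq_abs, abs_mul]
    have h1 : |K' (x - s)| ≤ (A + B * |x - s| ^ n) * Real.exp (-b * (x - s) ^ 2) := hbd (x - s)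
    have h2 : (A + B * |x - s| ^ n) ≤ A + B * (2 ^ n * (|s - θ| ^ n + 1)) := by
      nlinarith [hpow, hB]
    have h3 : 0 ≤ A + B * |x - s| ^ n := by positivity
    have h4 : 0 ≤ Real.exp (-b * (x - s) ^ 2) := (Real.exp_pos _).le
    calc |deriv tri s| * |K' (x - s)| ≤ 1 * ((A + B * |x - s| ^ n) * Real.exp (-b * (x - s) ^ 2)) :=
          mul_le_mul (abs_deriv_tri_le_one s) h1 (abs_nonneg _) zero_le_one
      _ ≤ (A + B * (2 ^ n * (|s - θ| ^ n + 1))) * (Real.exp b * Real.exp (-(b / 2) * (s - θ) ^ 2)) := by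
          rw [one_mul]
          exact mul_le_mul h2 hexp h4 (by positivity)
      _ = M s := by rw [hM]; ring
  have hbound_int : Integrable M := by
    have hb2 : 0 < b / 2 := by linarith
    have hpoly : Integrable (fun u : ℝ => |u| ^ n * Real.exp (-(b / 2) * u ^ 2)) := by
      have h := (integrable_rpow_mul_exp_neg_mul_sq hb2 (s := n) (by
        have : (0:ℝ) ≤ n := Nat.cast_nonneg n
        linarith)).abs
      refine h.congr (ae_of_all _ fun u => ?_)
      simp only [Real.rpow_natCast, abs_mul, abs_of_pos (Real.exp_pos _), abs_pow]
    have hg : Integrable (fun u : ℝ => Real.exp (-(b / 2) * u ^ 2)) := integrable_exp_neg_mul_sq hb2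
    have hsum : Integrable (fun u : ℝ => Real.exp b * (A + B * (2 ^ n * (|u| ^ n + 1))) *
        Real.exp (-(b / 2) * u ^ 2)) := by
      have := ((hpoly.const_mul (Real.exp b * B * 2 ^ n)).add (hg.const_mul (Real.exp b * (A + B * 2 ^ n))))
      refine this.congr (ae_of_all _ fun u => ?_)
      simp only [Pi.add_apply]
      ring
    have := hsum.comp_sub_right θ
    refine this.congr (ae_of_all _ fun s => ?_)
    simp only [hM]
  have h_diff : ∀ᵐ s : ℝ, ∀ x ∈ Metric.ball θ 1,
      HasDerivAt (fun x => deriv tri s * K (x - s)) (deriv tri s * K' (x - s)) x := by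
    refine ae_of_all _ fun s x _ => ?_
    have h := ((hK (x - s)).comp x ((hasDerivAt_id x).sub_const s)).const_mul (deriv tri s)
    rw [mul_one] at h
    exact h
  exact (hasDerivAt_integral_of_dominated_loc_of_deriv_le (μ := volume) (Metric.ball_mem_nhds θ one_pos)
    (Eventually.of_forall hmeas) hF_int hF'_meas h_bound hbound_int h_diff).2

/-! ### §3 The Gaussian derivatives `g_δ′, g_δ″, g_δ‴, g_δ⁗` -/

/-- `(g_δ′)′ = g_δ″`: `d/du[−(u/δ²)g_δ(u)] = (u²/δ⁴ − 1/δ²) g_δ(u)`. [cite: Folland1999, Prop. 2.53 (the Gaussian)] -/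
theorem hasDerivAt_gaussKernel_deriv1 (δ u : ℝ) :
    HasDerivAt (fun u => -(u / δ ^ 2) * gaussKernel δ u) ((u ^ 2 / δ ^ 4 - 1 / δ ^ 2) * gaussKernel δ u) u := by
  have h1 : HasDerivAt (fun u : ℝ => -(u / δ ^ 2)) (-(1 / δ ^ 2)) u := by
    have h0 : HasDerivAt (fun u : ℝ => u / δ ^ 2) (1 / δ ^ 2) u := (hasDerivAt_id u).div_const (δ ^ 2)
    exact h0.neg
  have h := h1.mul (hasDerivAt_gaussKernel δ u)
  refine h.congr_deriv ?_
  ring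

/-- `(g_δ″)′ = g_δ‴`: `d/du[(u²/δ⁴ − 1/δ²)g_δ(u)] = (3u/δ⁴ − u³/δ⁶) g_δ(u)`. [cite: Folland1999, Prop. 2.53 (the Gaussian)] -/
theorem hasDerivAt_gaussKernel_deriv2 (δ u : ℝ) :
    HasDerivAt (fun u => (u ^ 2 / δ ^ 4 - 1 / δ ^ 2) * gaussKernel δ u)
      ((3 * u / δ ^ 4 - u ^ 3 / δ ^ 6) * gaussKernel δ u) u := by
  have h1 : HasDerivAt (fun u : ℝ => u ^ 2 / δ ^ 4 - 1 / δ ^ 2) (2 * u / δ ^ 4) u := by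
    have := ((hasDerivAt_pow 2 u).div_const (δ ^ 4)).sub_const (1 / δ ^ 2)
    simpa using this
  have h := h1.mul (hasDerivAt_gaussKernel δ u)
  refine h.congr_deriv ?_
  rcases eq_or_ne δ 0 with hδ | hδ
  · subst hδ; simp [gaussKernel]
  · field_simp
    ring

/-- `(g_δ‴)′ = g_δ⁗`: `d/du[(3u/δ⁴ − u³/δ⁶)g_δ(u)] = (3/δ⁴ − 6u²/δ⁶ + u⁴/δ⁸) g_δ(u)`. [cite: Folland1999, Prop. 2.53 (the Gaussian)] -/
theorem hasDerivAt_gaussKernel_deriv3 (δ u : ℝ) :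
    HasDerivAt (fun u => (3 * u / δ ^ 4 - u ^ 3 / δ ^ 6) * gaussKernel δ u)
      ((3 / δ ^ 4 - 6 * u ^ 2 / δ ^ 6 + u ^ 4 / δ ^ 8) * gaussKernel δ u) u := by
  have h1 : HasDerivAt (fun u : ℝ => 3 * u / δ ^ 4 - u ^ 3 / δ ^ 6) (3 / δ ^ 4 - 3 * u ^ 2 / δ ^ 6) u := by
    have ha : HasDerivAt (fun u : ℝ => 3 * u / δ ^ 4) (3 / δ ^ 4) u := by
      have := ((hasDerivAt_id u).const_mul 3).div_const (δ ^ 4)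
      simpa using this
    have hb : HasDerivAt (fun u : ℝ => u ^ 3 / δ ^ 6) (3 * u ^ 2 / δ ^ 6) u := by
      have := (hasDerivAt_pow 3 u).div_const (δ ^ 6)
      simpa using this
    exact ha.sub hb
  have h := h1.mul (hasDerivAt_gaussKernel δ u)
  refine h.congr_deriv ?_
  rcases eq_or_ne δ 0 with hδ | hδ
  · subst hδ; simp [gaussKernel]
  · field_simp
    ring

/-- Gaussian-times-polynomial bound for `g_δ″`: `|g_δ″(u)| ≤ (1/δ² + |u|²/δ⁴) g_δ(u)`, in the form
`(A + B|u|²) e^{−u²/(2δ²)}`. [cite: Folland1999, Prop. 2.53 (the Gaussian)] -/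
theorem abs_gaussKernel_deriv2_le {δ : ℝ} (hδ : 0 < δ) (u : ℝ) :
    |(u ^ 2 / δ ^ 4 - 1 / δ ^ 2) * gaussKernel δ u| ≤
      (1 / (δ ^ 2 * (δ * Real.sqrt (2 * Real.pi))) + 1 / (δ ^ 4 * (δ * Real.sqrt (2 * Real.pi))) * |u| ^ 2) *
        Real.exp (-(1 / (2 * δ ^ 2)) * u ^ 2) := by
  have hc : 0 < δ * Real.sqrt (2 * Real.pi) := by positivity
  have hg : gaussKernel δ u = Real.exp (-(1 / (2 * δ ^ 2)) * u ^ 2) / (δ * Real.sqrt (2 * Real.pi)) := by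
    simp only [gaussKernel]; ring_nf
  rw [abs_mul, abs_of_nonneg (gaussKernel_nonneg hδ.le u), hg]
  have h1 : |u ^ 2 / δ ^ 4 - 1 / δ ^ 2| ≤ 1 / δ ^ 2 + 1 / δ ^ 4 * |u| ^ 2 := by
    rw [sq_abs]
    calc |u ^ 2 / δ ^ 4 - 1 / δ ^ 2| ≤ |u ^ 2 / δ ^ 4| + |1 / δ ^ 2| := abs_sub _ _
      _ = 1 / δ ^ 2 + 1 / δ ^ 4 * u ^ 2 := by
          rw [abs_of_nonneg (by positivity), abs_of_nonneg (by positivity)]; ring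
  have he : 0 ≤ Real.exp (-(1 / (2 * δ ^ 2)) * u ^ 2) := (Real.exp_pos _).le
  calc |u ^ 2 / δ ^ 4 - 1 / δ ^ 2| * (Real.exp (-(1 / (2 * δ ^ 2)) * u ^ 2) / (δ * Real.sqrt (2 * Real.pi)))
      ≤ (1 / δ ^ 2 + 1 / δ ^ 4 * |u| ^ 2) * (Real.exp (-(1 / (2 * δ ^ 2)) * u ^ 2) / (δ * Real.sqrt (2 * Real.pi))) :=
        mul_le_mul_of_nonneg_right h1 (by positivity)
    _ = _ := by
        field_simp

/-- Gaussian-times-polynomial bound for `g_δ‴`: `|g_δ‴(u)| ≤ (3|u|/δ⁴ + |u|³/δ⁶) g_δ(u) ≤ (A + B|u|³)e^{−u²/(2δ²)}`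
with `A = 3/(δ⁴c)`, `B = (3/δ⁴ + 1/δ⁶)/c`, `c = δ√(2π)` (`|u| ≤ 1 + |u|³`). [cite: Folland1999, Prop. 2.53 (the Gaussian)] -/
theorem abs_gaussKernel_deriv3_le {δ : ℝ} (hδ : 0 < δ) (u : ℝ) :
    |(3 * u / δ ^ 4 - u ^ 3 / δ ^ 6) * gaussKernel δ u| ≤
      (3 / (δ ^ 4 * (δ * Real.sqrt (2 * Real.pi))) +
          (3 / δ ^ 4 + 1 / δ ^ 6) / (δ * Real.sqrt (2 * Real.pi)) * |u| ^ 3) *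
        Real.exp (-(1 / (2 * δ ^ 2)) * u ^ 2) := by
  have hc : 0 < δ * Real.sqrt (2 * Real.pi) := by positivity
  have hg : gaussKernel δ u = Real.exp (-(1 / (2 * δ ^ 2)) * u ^ 2) / (δ * Real.sqrt (2 * Real.pi)) := by
    simp only [gaussKernel]; ring_nf
  rw [abs_mul, abs_of_nonneg (gaussKernel_nonneg hδ.le u), hg]
  have hu3 : |u| ≤ 1 + |u| ^ 3 := by
    have := abs_pow_le_one_add_abs_pow u (j := 1) (n := 3) (by norm_num)
    simpa using this
  have h1 : |3 * u / δ ^ 4 - u ^ 3 / δ ^ 6| ≤ 3 / δ ^ 4 + (3 / δ ^ 4 + 1 / δ ^ 6) * |u| ^ 3 := by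
    calc |3 * u / δ ^ 4 - u ^ 3 / δ ^ 6| ≤ |3 * u / δ ^ 4| + |u ^ 3 / δ ^ 6| := abs_sub _ _
      _ = 3 / δ ^ 4 * |u| + 1 / δ ^ 6 * |u| ^ 3 := by
          rw [abs_div, abs_div, abs_mul, abs_of_pos (by positivity : (0:ℝ) < δ ^ 4),
            abs_of_pos (by positivity : (0:ℝ) < δ ^ 6), abs_of_pos (by norm_num : (0:ℝ) < 3), abs_pow]
          ring
      _ ≤ 3 / δ ^ 4 * (1 + |u| ^ 3) + 1 / δ ^ 6 * |u| ^ 3 := by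
          gcongr
      _ = 3 / δ ^ 4 + (3 / δ ^ 4 + 1 / δ ^ 6) * |u| ^ 3 := by ring
  calc |3 * u / δ ^ 4 - u ^ 3 / δ ^ 6| * (Real.exp (-(1 / (2 * δ ^ 2)) * u ^ 2) / (δ * Real.sqrt (2 * Real.pi)))
      ≤ (3 / δ ^ 4 + (3 / δ ^ 4 + 1 / δ ^ 6) * |u| ^ 3) *
          (Real.exp (-(1 / (2 * δ ^ 2)) * u ^ 2) / (δ * Real.sqrt (2 * Real.pi))) :=
        mul_le_mul_of_nonneg_right h1 (by positivity)
    _ = _ := by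
        field_simp

/-- Gaussian-times-polynomial bound for `g_δ⁗`: `|g_δ⁗(u)| ≤ (3/δ⁴ + 6u²/δ⁶ + u⁴/δ⁸) g_δ(u) ≤ (A + B u⁴)e^{−u²/(2δ²)}`
with `A = (3/δ⁴ + 6/δ⁶)/c`, `B = (6/δ⁶ + 1/δ⁸)/c`, `c = δ√(2π)` (`u² ≤ 1 + u⁴`). [cite: Folland1999, Prop. 2.53 (the Gaussian)] -/
theorem abs_gaussKernel_deriv4_le {δ : ℝ} (hδ : 0 < δ) (u : ℝ) :
    |(3 / δ ^ 4 - 6 * u ^ 2 / δ ^ 6 + u ^ 4 / δ ^ 8) * gaussKernel δ u| ≤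
      ((3 / δ ^ 4 + 6 / δ ^ 6) / (δ * Real.sqrt (2 * Real.pi)) +
          (6 / δ ^ 6 + 1 / δ ^ 8) / (δ * Real.sqrt (2 * Real.pi)) * |u| ^ 4) *
        Real.exp (-(1 / (2 * δ ^ 2)) * u ^ 2) := by
  have hc : 0 < δ * Real.sqrt (2 * Real.pi) := by positivity
  have hg : gaussKernel δ u = Real.exp (-(1 / (2 * δ ^ 2)) * u ^ 2) / (δ * Real.sqrt (2 * Real.pi)) := by
    simp only [gaussKernel]; ring_nf
  rw [abs_mul, abs_of_nonneg (gaussKernel_nonneg hδ.le u), hg]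
  have hu2 : |u| ^ 2 ≤ 1 + |u| ^ 4 := abs_pow_le_one_add_abs_pow u (by norm_num)
  have h1 : |3 / δ ^ 4 - 6 * u ^ 2 / δ ^ 6 + u ^ 4 / δ ^ 8| ≤
      (3 / δ ^ 4 + 6 / δ ^ 6) + (6 / δ ^ 6 + 1 / δ ^ 8) * |u| ^ 4 := by
    have e2 : u ^ 2 = |u| ^ 2 := (sq_abs u).symm
    have e4 : u ^ 4 = |u| ^ 4 := by rw [show (4:ℕ) = 2 * 2 from rfl, pow_mul, pow_mul, sq_abs]
    calc |3 / δ ^ 4 - 6 * u ^ 2 / δ ^ 6 + u ^ 4 / δ ^ 8|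
        ≤ |3 / δ ^ 4 - 6 * u ^ 2 / δ ^ 6| + |u ^ 4 / δ ^ 8| := abs_add_le _ _
      _ ≤ (|3 / δ ^ 4| + |6 * u ^ 2 / δ ^ 6|) + |u ^ 4 / δ ^ 8| := by gcongr; exact abs_sub _ _
      _ = 3 / δ ^ 4 + 6 / δ ^ 6 * |u| ^ 2 + 1 / δ ^ 8 * |u| ^ 4 := by
          rw [e2, e4, abs_of_pos (by positivity : (0:ℝ) < 3 / δ ^ 4),
            abs_of_nonneg (by positivity : (0:ℝ) ≤ 6 * |u| ^ 2 / δ ^ 6),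
            abs_of_nonneg (by positivity : (0:ℝ) ≤ |u| ^ 4 / δ ^ 8)]
          ring
      _ ≤ 3 / δ ^ 4 + 6 / δ ^ 6 * (1 + |u| ^ 4) + 1 / δ ^ 8 * |u| ^ 4 := by gcongr
      _ = (3 / δ ^ 4 + 6 / δ ^ 6) + (6 / δ ^ 6 + 1 / δ ^ 8) * |u| ^ 4 := by ring
  calc |3 / δ ^ 4 - 6 * u ^ 2 / δ ^ 6 + u ^ 4 / δ ^ 8| *
        (Real.exp (-(1 / (2 * δ ^ 2)) * u ^ 2) / (δ * Real.sqrt (2 * Real.pi)))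
      ≤ ((3 / δ ^ 4 + 6 / δ ^ 6) + (6 / δ ^ 6 + 1 / δ ^ 8) * |u| ^ 4) *
          (Real.exp (-(1 / (2 * δ ^ 2)) * u ^ 2) / (δ * Real.sqrt (2 * Real.pi))) :=
        mul_le_mul_of_nonneg_right h1 (by positivity)
    _ = _ := by
        field_simp

/-! ### §4 Gaussian moments: `∫u²g_δ = δ²`, `∫|u|³g_δ = 4δ³/√(2π)`, `∫u⁴g_δ = 3δ⁴` -/

/-- `u ↦ |u|ⁿ g_δ(u)` is integrable (`δ > 0`). [cite: Folland1999, Prop. 2.53 (Gaussian integrals)] -/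
theorem integrable_abs_pow_mul_gaussKernel {δ : ℝ} (hδ : 0 < δ) (n : ℕ) :
    Integrable (fun u => |u| ^ n * gaussKernel δ u) := by
  have hb : 0 < 1 / (2 * δ ^ 2) := by positivity
  have h1 : Integrable (fun u : ℝ => |u ^ (n : ℝ) * Real.exp (-(1 / (2 * δ ^ 2)) * u ^ 2)|) :=
    (integrable_rpow_mul_exp_neg_mul_sq hb (s := n) (by have : (0:ℝ) ≤ n := Nat.cast_nonneg n; linarith)).abs
  have h2 := h1.div_const (δ * Real.sqrt (2 * Real.pi))
  refine h2.congr (ae_of_all _ fun u => ?_)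
  simp only [gaussKernel, Real.rpow_natCast, abs_mul, abs_pow, abs_of_pos (Real.exp_pos _)]
  ring_nf

/-- `u ↦ uⁿ g_δ(u)` is integrable (`δ > 0`). [cite: Folland1999, Prop. 2.53 (Gaussian integrals)] -/
theorem integrable_pow_mul_gaussKernel {δ : ℝ} (hδ : 0 < δ) (n : ℕ) :
    Integrable (fun u => u ^ n * gaussKernel δ u) := by
  refine (integrable_abs_pow_mul_gaussKernel hδ n).mono' ?_ (ae_of_all _ fun u => ?_)
  · exact ((continuous_id.pow n).mul (continuous_gaussKernel δ)).aestronglyMeasurable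
  · rw [Real.norm_eq_abs, abs_mul, abs_pow, abs_of_nonneg (gaussKernel_nonneg hδ.le u)]

/-- `x^{3/2} = x √x` for `x ≥ 0`. [folklore] -/
private theorem rpow_three_halves {x : ℝ} (hx : 0 ≤ x) : x ^ ((3 : ℝ) / 2) = x * Real.sqrt x := by
  rw [show (3 : ℝ) / 2 = 1 + 1 / 2 by norm_num, Real.rpow_add' hx (by norm_num), Real.rpow_one,
    Real.sqrt_eq_rpow]

/-- `x^{5/2} = x² √x` for `x ≥ 0`. [folklore] -/
private theorem rpow_five_halves {x : ℝ} (hx : 0 ≤ x) : x ^ ((5 : ℝ) / 2) = x ^ 2 * Real.sqrt x := by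
  rw [show (5 : ℝ) / 2 = 2 + 1 / 2 by norm_num, Real.rpow_add' hx (by norm_num), Real.rpow_two,
    Real.sqrt_eq_rpow]

/-- The half-line Gaussian moment `∫₀^∞ xⁿ e^{−bx²} dx = b^{−(n+1)/2} Γ((n+1)/2)/2` for natural `n`
(Mathlib's `integral_rpow_mul_exp_neg_mul_rpow` read with natural powers). [cite: Folland1999, Prop. 2.53 (Gaussian integrals)] -/
theorem integral_Ioi_pow_mul_exp_neg_mul_sq {b : ℝ} (hb : 0 < b) (n : ℕ) :
    ∫ x in Ioi (0 : ℝ), x ^ n * Real.exp (-b * x ^ 2) =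
      b ^ (-((n : ℝ) + 1) / 2) * (1 / 2) * Real.Gamma (((n : ℝ) + 1) / 2) := by
  have h := integral_rpow_mul_exp_neg_mul_rpow (p := 2) (q := n) (by norm_num)
    (by have : (0:ℝ) ≤ n := Nat.cast_nonneg n; linarith) hb
  have e : ∫ x in Ioi (0 : ℝ), x ^ n * Real.exp (-b * x ^ 2) =
      ∫ x in Ioi (0 : ℝ), x ^ (n : ℝ) * Real.exp (-b * x ^ (2 : ℝ)) := by
    refine setIntegral_congr_fun measurableSet_Ioi fun x _ => ?_
    simp [Real.rpow_natCast]
  rw [e, h]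

/-- **Second moment**: `∫ u² g_δ(u) du = δ²` (`δ > 0`). [cite: Folland1999, Prop. 2.53 (Gaussian integrals)] -/
theorem integral_sq_mul_gaussKernel {δ : ℝ} (hδ : 0 < δ) : ∫ u, u ^ 2 * gaussKernel δ u = δ ^ 2 := by
  have hb : 0 < 1 / (2 * δ ^ 2) := by positivity
  have hc : 0 < δ * Real.sqrt (2 * Real.pi) := by positivity
  set f : ℝ → ℝ := fun v => v ^ 2 * Real.exp (-(1 / (2 * δ ^ 2)) * v ^ 2) / (δ * Real.sqrt (2 * Real.pi)) with hf
  have hfun : (fun u => u ^ 2 * gaussKernel δ u) = fun u => f |u| := by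
    funext u
    simp only [hf, gaussKernel, sq_abs]
    ring_nf
  rw [hfun, integral_comp_abs]
  have hI : ∫ x in Ioi (0 : ℝ), f x =
      ((1 / (2 * δ ^ 2)) ^ (-((2 : ℕ) + 1 : ℝ) / 2) * (1 / 2) * Real.Gamma ((((2 : ℕ) : ℝ) + 1) / 2)) /
        (δ * Real.sqrt (2 * Real.pi)) := by
    simp only [hf]
    rw [integral_div, ← integral_Ioi_pow_mul_exp_neg_mul_sq hb 2]
  rw [hI]
  have hG : Real.Gamma ((((2 : ℕ) : ℝ) + 1) / 2) = Real.sqrt Real.pi / 2 := by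
    rw [show (((2 : ℕ) : ℝ) + 1) / 2 = 1 / 2 + 1 by norm_num, Real.Gamma_add_one (by norm_num),
      Real.Gamma_one_half_eq]
    ring
  have hpow : (1 / (2 * δ ^ 2)) ^ (-((2 : ℕ) + 1 : ℝ) / 2) = 2 * δ ^ 2 * (Real.sqrt 2 * δ) := by
    rw [show (-((2 : ℕ) + 1 : ℝ) / 2) = -((3 : ℝ) / 2) by norm_num, Real.rpow_neg (by positivity),
      one_div, Real.inv_rpow (by positivity), inv_inv, rpow_three_halves (by positivity),
      Real.sqrt_mul' _ (sq_nonneg δ), Real.sqrt_sq hδ.le]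
  rw [hG, hpow]
  have hs2 : Real.sqrt (2 * Real.pi) = Real.sqrt 2 * Real.sqrt Real.pi := Real.sqrt_mul (by norm_num) _
  rw [hs2]
  have h2 : Real.sqrt 2 ≠ 0 := by positivity
  have hπ : Real.sqrt Real.pi ≠ 0 := by positivity
  field_simp

/-- **Third absolute moment**: `∫ |u|³ g_δ(u) du = 4δ³/√(2π)` (`δ > 0`). [cite: Folland1999, Prop. 2.53 (Gaussian integrals)] -/
theorem integral_abs_pow_three_mul_gaussKernel {δ : ℝ} (hδ : 0 < δ) :
    ∫ u, |u| ^ 3 * gaussKernel δ u = 4 * δ ^ 3 / Real.sqrt (2 * Real.pi) := by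
  have hb : 0 < 1 / (2 * δ ^ 2) := by positivity
  have hc : 0 < δ * Real.sqrt (2 * Real.pi) := by positivity
  set f : ℝ → ℝ := fun v => v ^ 3 * Real.exp (-(1 / (2 * δ ^ 2)) * v ^ 2) / (δ * Real.sqrt (2 * Real.pi)) with hf
  have hfun : (fun u => |u| ^ 3 * gaussKernel δ u) = fun u => f |u| := by
    funext u
    simp only [hf, gaussKernel, sq_abs]
    ring_nf
  rw [hfun, integral_comp_abs]
  have hI : ∫ x in Ioi (0 : ℝ), f x =
      ((1 / (2 * δ ^ 2)) ^ (-((3 : ℕ) + 1 : ℝ) / 2) * (1 / 2) * Real.Gamma ((((3 : ℕ) : ℝ) + 1) / 2)) /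
        (δ * Real.sqrt (2 * Real.pi)) := by
    simp only [hf]
    rw [integral_div, ← integral_Ioi_pow_mul_exp_neg_mul_sq hb 3]
  rw [hI]
  have hG : Real.Gamma ((((3 : ℕ) : ℝ) + 1) / 2) = 1 := by
    rw [show (((3 : ℕ) : ℝ) + 1) / 2 = 1 + 1 by norm_num, Real.Gamma_add_one one_ne_zero, Real.Gamma_one, mul_one]
  have hpow : (1 / (2 * δ ^ 2)) ^ (-((3 : ℕ) + 1 : ℝ) / 2) = (2 * δ ^ 2) ^ 2 := by
    rw [show (-((3 : ℕ) + 1 : ℝ) / 2) = -(2 : ℝ) by norm_num, Real.rpow_neg (by positivity),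
      one_div, Real.inv_rpow (by positivity), inv_inv, Real.rpow_two]
  rw [hG, hpow]
  field_simp
  ring

/-- **Fourth moment**: `∫ u⁴ g_δ(u) du = 3δ⁴` (`δ > 0`). [cite: Folland1999, Prop. 2.53 (Gaussian integrals)] -/
theorem integral_pow_four_mul_gaussKernel {δ : ℝ} (hδ : 0 < δ) : ∫ u, u ^ 4 * gaussKernel δ u = 3 * δ ^ 4 := by
  have hb : 0 < 1 / (2 * δ ^ 2) := by positivity
  have hc : 0 < δ * Real.sqrt (2 * Real.pi) := by positivity
  set f : ℝ → ℝ := fun v => v ^ 4 * Real.exp (-(1 / (2 * δ ^ 2)) * v ^ 2) / (δ * Real.sqrt (2 * Real.pi)) with hf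
  have hfun : (fun u => u ^ 4 * gaussKernel δ u) = fun u => f |u| := by
    funext u
    have e4 : |u| ^ 4 = u ^ 4 := by rw [show (4:ℕ) = 2 * 2 from rfl, pow_mul, pow_mul, sq_abs]
    simp only [hf, gaussKernel, sq_abs, e4]
    ring_nf
  rw [hfun, integral_comp_abs]
  have hI : ∫ x in Ioi (0 : ℝ), f x =
      ((1 / (2 * δ ^ 2)) ^ (-((4 : ℕ) + 1 : ℝ) / 2) * (1 / 2) * Real.Gamma ((((4 : ℕ) : ℝ) + 1) / 2)) /
        (δ * Real.sqrt (2 * Real.pi)) := by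
    simp only [hf]
    rw [integral_div, ← integral_Ioi_pow_mul_exp_neg_mul_sq hb 4]
  rw [hI]
  have hG : Real.Gamma ((((4 : ℕ) : ℝ) + 1) / 2) = 3 * Real.sqrt Real.pi / 4 := by
    rw [show (((4 : ℕ) : ℝ) + 1) / 2 = 3 / 2 + 1 by norm_num, Real.Gamma_add_one (by norm_num),
      show (3 : ℝ) / 2 = 1 / 2 + 1 by norm_num, Real.Gamma_add_one (by norm_num), Real.Gamma_one_half_eq]
    ring
  have hpow : (1 / (2 * δ ^ 2)) ^ (-((4 : ℕ) + 1 : ℝ) / 2) = (2 * δ ^ 2) ^ 2 * (Real.sqrt 2 * δ) := by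
    rw [show (-((4 : ℕ) + 1 : ℝ) / 2) = -((5 : ℝ) / 2) by norm_num, Real.rpow_neg (by positivity),
      one_div, Real.inv_rpow (by positivity), inv_inv, rpow_five_halves (by positivity),
      Real.sqrt_mul' _ (sq_nonneg δ), Real.sqrt_sq hδ.le]
  rw [hG, hpow]
  have hs2 : Real.sqrt (2 * Real.pi) = Real.sqrt 2 * Real.sqrt Real.pi := Real.sqrt_mul (by norm_num) _
  rw [hs2]
  have h2 : Real.sqrt 2 ≠ 0 := by positivity
  have hπ : Real.sqrt Real.pi ≠ 0 := by positivity
  have hss : Real.sqrt 2 * Real.sqrt 2 = 2 := Real.mul_self_sqrt (by norm_num)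
  field_simp
  nlinarith [hss]

/-- `u ↦ |u|³ g_δ(u)` is integrable (`δ > 0`). [cite: Folland1999, Prop. 2.53 (Gaussian integrals)] -/
theorem integrable_abs_pow_three_mul_gaussKernel_int {δ : ℝ} (hδ : 0 < δ) :
    Integrable (fun u => |u| ^ 3 * gaussKernel δ u / δ ^ 6) :=
  (integrable_abs_pow_mul_gaussKernel hδ 3).div_const (δ ^ 6)

/-! ### §5 `S_δ‴`, `S_δ⁗`, `S_δ⁽⁵⁾` and their sup bounds -/

/-- `g_δ′` is integrable. [cite: Folland1999, Prop. 2.53 (Gaussian integrals)] -/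
theorem integrable_gaussKernel_deriv1 {δ : ℝ} (hδ : 0 < δ) :
    Integrable (fun u => -(u / δ ^ 2) * gaussKernel δ u) := by
  refine (((integrable_pow_mul_gaussKernel hδ 1).div_const (δ ^ 2)).neg).congr (ae_of_all _ fun u => ?_)
  simp only [pow_one, Pi.neg_apply]
  ring

/-- `g_δ″` is integrable. [cite: Folland1999, Prop. 2.53 (Gaussian integrals)] -/
theorem integrable_gaussKernel_deriv2 {δ : ℝ} (hδ : 0 < δ) :
    Integrable (fun u => (u ^ 2 / δ ^ 4 - 1 / δ ^ 2) * gaussKernel δ u) := by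
  refine ((((integrable_pow_mul_gaussKernel hδ 2).div_const (δ ^ 4)).sub
    ((integrable_gaussKernel hδ).div_const (δ ^ 2)))).congr (ae_of_all _ fun u => ?_)
  simp only [Pi.sub_apply]
  ring

/-- `g_δ‴` is integrable. [cite: Folland1999, Prop. 2.53 (Gaussian integrals)] -/
theorem integrable_gaussKernel_deriv3 {δ : ℝ} (hδ : 0 < δ) :
    Integrable (fun u => (3 * u / δ ^ 4 - u ^ 3 / δ ^ 6) * gaussKernel δ u) := by
  refine (((((integrable_pow_mul_gaussKernel hδ 1).div_const (δ ^ 4)).const_mul 3).sub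
    ((integrable_pow_mul_gaussKernel hδ 3).div_const (δ ^ 6)))).congr (ae_of_all _ fun u => ?_)
  simp only [Pi.sub_apply, pow_one]
  ring

/-- `S_δ″ = tri′ ⋆ g_δ′` as functions. [cite: Folland1999, §8.2 Prop. 8.10 (∂(f ∗ g) = f ∗ ∂g)] -/
theorem deriv2_roundedSaw_eq {δ : ℝ} (hδ : 0 < δ) :
    deriv (deriv (roundedSaw δ)) = fun x => ∫ s, deriv tri s * ((fun u => -(u / δ ^ 2) * gaussKernel δ u) (x - s)) :=
  funext fun x => (hasDerivAt_deriv_roundedSaw hδ x).deriv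

/-- **`S_δ‴ = tri′ ⋆ g_δ″`**: `S_δ″` is differentiable with derivative `∫ tri′(s) g_δ″(θ − s) ds`,
`g_δ″(u) = (u²/δ⁴ − 1/δ²) g_δ(u)`. [cite: Folland1999, §8.2 Prop. 8.10 with Thm. 2.27 (differentiating a convolution)] -/
theorem hasDerivAt_deriv2_roundedSaw {δ : ℝ} (hδ : 0 < δ) (θ : ℝ) :
    HasDerivAt (deriv (deriv (roundedSaw δ)))
      (∫ s, deriv tri s * (((θ - s) ^ 2 / δ ^ 4 - 1 / δ ^ 2) * gaussKernel δ (θ - s))) θ := by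
  rw [deriv2_roundedSaw_eq hδ]
  have hc : 0 < δ * Real.sqrt (2 * Real.pi) := by positivity
  have hK1c : Continuous (fun u : ℝ => -(u / δ ^ 2) * gaussKernel δ u) :=
    ((continuous_id.div_const _).neg).mul (continuous_gaussKernel δ)
  have hK2c : Continuous (fun u : ℝ => (u ^ 2 / δ ^ 4 - 1 / δ ^ 2) * gaussKernel δ u) :=
    (((continuous_pow 2).div_const _).sub continuous_const).mul (continuous_gaussKernel δ)
  exact hasDerivAt_integral_deriv_tri_mul (hasDerivAt_gaussKernel_deriv1 δ) hK1c hK2c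
    (integrable_gaussKernel_deriv1 hδ) (by positivity) (by positivity) (by positivity : (0:ℝ) < 1 / (2 * δ ^ 2)) 2
    (abs_gaussKernel_deriv2_le hδ) θ

/-- **`|S_δ‴(θ)| ≤ 2/δ²`** for every `θ` (`δ > 0`): `|S_δ‴| ≤ ∫|g_δ″| ≤ ∫ (u²/δ⁴ + 1/δ²) g_δ = δ²/δ⁴ + 1/δ²`.
[cite: Folland1999, §8.2 Prop. 8.8 (‖f ∗ g‖_u ≤ ‖f‖_∞ ‖g‖₁) and Prop. 8.10] -/
theorem abs_deriv3_roundedSaw_le {δ : ℝ} (hδ : 0 < δ) (θ : ℝ) :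
    |deriv (deriv (deriv (roundedSaw δ))) θ| ≤ 2 / δ ^ 2 := by
  rw [(hasDerivAt_deriv2_roundedSaw hδ θ).deriv]
  have hBint : Integrable (fun s => ((θ - s) ^ 2 / δ ^ 4 + 1 / δ ^ 2) * gaussKernel δ (θ - s)) := by
    have h := ((((integrable_pow_mul_gaussKernel hδ 2).div_const (δ ^ 4)).add
      ((integrable_gaussKernel hδ).div_const (δ ^ 2)))).comp_sub_left θ
    refine h.congr (ae_of_all _ fun s => ?_)
    simp only [Pi.add_apply]
    ring
  have hval : ∫ s, ((θ - s) ^ 2 / δ ^ 4 + 1 / δ ^ 2) * gaussKernel δ (θ - s) = 2 / δ ^ 2 := by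
    have hsub := integral_sub_left_eq_self (fun u => (u ^ 2 / δ ^ 4 + 1 / δ ^ 2) * gaussKernel δ u) volume θ
    rw [hsub]
    have i1 := (integrable_pow_mul_gaussKernel hδ 2).div_const (δ ^ 4)
    have i2 := (integrable_gaussKernel hδ).div_const (δ ^ 2)
    have e : (fun u => (u ^ 2 / δ ^ 4 + 1 / δ ^ 2) * gaussKernel δ u) =
        fun u => u ^ 2 * gaussKernel δ u / δ ^ 4 + gaussKernel δ u / δ ^ 2 := by
      funext u; ring
    rw [e, integral_add i1 i2, integral_div, integral_div, integral_sq_mul_gaussKernel hδ, integral_gaussKernel hδ]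
    field_simp
    ring
  calc |∫ s, deriv tri s * (((θ - s) ^ 2 / δ ^ 4 - 1 / δ ^ 2) * gaussKernel δ (θ - s))|
      ≤ ∫ s, ((θ - s) ^ 2 / δ ^ 4 + 1 / δ ^ 2) * gaussKernel δ (θ - s) := by
        rw [← Real.norm_eq_abs]
        refine norm_integral_le_of_norm_le hBint (ae_of_all _ fun s => ?_)
        rw [Real.norm_eq_abs, abs_mul, abs_mul, abs_of_nonneg (gaussKernel_nonneg hδ.le _)]
        have hg0 : 0 ≤ gaussKernel δ (θ - s) := gaussKernel_nonneg hδ.le _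
        have h1 : |(θ - s) ^ 2 / δ ^ 4 - 1 / δ ^ 2| ≤ (θ - s) ^ 2 / δ ^ 4 + 1 / δ ^ 2 := by
          calc |(θ - s) ^ 2 / δ ^ 4 - 1 / δ ^ 2| ≤ |(θ - s) ^ 2 / δ ^ 4| + |1 / δ ^ 2| := abs_sub _ _
            _ = (θ - s) ^ 2 / δ ^ 4 + 1 / δ ^ 2 := by
                rw [abs_of_nonneg (by positivity), abs_of_nonneg (by positivity)]
        calc |deriv tri s| * (|(θ - s) ^ 2 / δ ^ 4 - 1 / δ ^ 2| * gaussKernel δ (θ - s))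
            ≤ 1 * (((θ - s) ^ 2 / δ ^ 4 + 1 / δ ^ 2) * gaussKernel δ (θ - s)) :=
              mul_le_mul (abs_deriv_tri_le_one s) (mul_le_mul_of_nonneg_right h1 hg0) (by positivity) zero_le_one
          _ = _ := one_mul _
    _ = 2 / δ ^ 2 := hval

/-- `S_δ‴ = tri′ ⋆ g_δ″` as functions. [cite: Folland1999, §8.2 Prop. 8.10 (∂(f ∗ g) = f ∗ ∂g)] -/
theorem deriv3_roundedSaw_eq {δ : ℝ} (hδ : 0 < δ) :
    deriv (deriv (deriv (roundedSaw δ))) =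
      fun x => ∫ s, deriv tri s * ((fun u => (u ^ 2 / δ ^ 4 - 1 / δ ^ 2) * gaussKernel δ u) (x - s)) :=
  funext fun x => (hasDerivAt_deriv2_roundedSaw hδ x).deriv

/-- **`S_δ⁗ = tri′ ⋆ g_δ‴`**: `S_δ‴` is differentiable with derivative `∫ tri′(s) g_δ‴(θ − s) ds`,
`g_δ‴(u) = (3u/δ⁴ − u³/δ⁶) g_δ(u)`. [cite: Folland1999, §8.2 Prop. 8.10 with Thm. 2.27 (differentiating a convolution)] -/
theorem hasDerivAt_deriv3_roundedSaw {δ : ℝ} (hδ : 0 < δ) (θ : ℝ) :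
    HasDerivAt (deriv (deriv (deriv (roundedSaw δ))))
      (∫ s, deriv tri s * ((3 * (θ - s) / δ ^ 4 - (θ - s) ^ 3 / δ ^ 6) * gaussKernel δ (θ - s))) θ := by
  rw [deriv3_roundedSaw_eq hδ]
  have hc : 0 < δ * Real.sqrt (2 * Real.pi) := by positivity
  have hK2c : Continuous (fun u : ℝ => (u ^ 2 / δ ^ 4 - 1 / δ ^ 2) * gaussKernel δ u) :=
    (((continuous_pow 2).div_const _).sub continuous_const).mul (continuous_gaussKernel δ)
  have hK3c : Continuous (fun u : ℝ => (3 * u / δ ^ 4 - u ^ 3 / δ ^ 6) * gaussKernel δ u) :=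
    (((continuous_const.mul continuous_id).div_const _).sub ((continuous_pow 3).div_const _)).mul
      (continuous_gaussKernel δ)
  exact hasDerivAt_integral_deriv_tri_mul (hasDerivAt_gaussKernel_deriv2 δ) hK2c hK3c
    (integrable_gaussKernel_deriv2 hδ) (by positivity) (by positivity) (by positivity : (0:ℝ) < 1 / (2 * δ ^ 2)) 3
    (abs_gaussKernel_deriv3_le hδ) θ

/-- **`|S_δ⁗(θ)| ≤ 10/(δ³√(2π))`** for every `θ` (`δ > 0`):
`|S_δ⁗| ≤ ∫|g_δ‴| ≤ ∫ (3|u|/δ⁴ + |u|³/δ⁶) g_δ = 6/(δ³√(2π)) + 4/(δ³√(2π))`.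
[cite: Folland1999, §8.2 Prop. 8.8 (‖f ∗ g‖_u ≤ ‖f‖_∞ ‖g‖₁) and Prop. 8.10] -/
theorem abs_deriv4_roundedSaw_le {δ : ℝ} (hδ : 0 < δ) (θ : ℝ) :
    |deriv (deriv (deriv (deriv (roundedSaw δ)))) θ| ≤ 10 / (δ ^ 3 * Real.sqrt (2 * Real.pi)) := by
  rw [(hasDerivAt_deriv3_roundedSaw hδ θ).deriv]
  have hc : 0 < δ * Real.sqrt (2 * Real.pi) := by positivity
  have hBint : Integrable (fun s => (3 * |θ - s| / δ ^ 4 + |θ - s| ^ 3 / δ ^ 6) * gaussKernel δ (θ - s)) := by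
    have h := (((((integrable_abs_pow_mul_gaussKernel hδ 1).div_const (δ ^ 4)).const_mul 3).add
      ((integrable_abs_pow_mul_gaussKernel hδ 3).div_const (δ ^ 6)))).comp_sub_left θ
    refine h.congr (ae_of_all _ fun s => ?_)
    simp only [Pi.add_apply, pow_one]
    ring
  have hval : ∫ s, (3 * |θ - s| / δ ^ 4 + |θ - s| ^ 3 / δ ^ 6) * gaussKernel δ (θ - s) =
      10 / (δ ^ 3 * Real.sqrt (2 * Real.pi)) := by
    have hsub := integral_sub_left_eq_self (fun u => (3 * |u| / δ ^ 4 + |u| ^ 3 / δ ^ 6) * gaussKernel δ u) volume θ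
    rw [hsub]
    have i1 := ((integrable_abs_mul_gaussKernel hδ).div_const (δ ^ 4)).const_mul 3
    have i2 := (integrable_abs_pow_three_mul_gaussKernel_int hδ)
    have e : (fun u => (3 * |u| / δ ^ 4 + |u| ^ 3 / δ ^ 6) * gaussKernel δ u) =
        fun u => 3 * (|u| * gaussKernel δ u / δ ^ 4) + |u| ^ 3 * gaussKernel δ u / δ ^ 6 := by
      funext u; ring
    rw [e, integral_add i1 i2, integral_const_mul, integral_div, integral_div, integral_abs_mul_gaussKernel hδ,
      integral_abs_pow_three_mul_gaussKernel hδ]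
    field_simp
    ring
  calc |∫ s, deriv tri s * ((3 * (θ - s) / δ ^ 4 - (θ - s) ^ 3 / δ ^ 6) * gaussKernel δ (θ - s))|
      ≤ ∫ s, (3 * |θ - s| / δ ^ 4 + |θ - s| ^ 3 / δ ^ 6) * gaussKernel δ (θ - s) := by
        rw [← Real.norm_eq_abs]
        refine norm_integral_le_of_norm_le hBint (ae_of_all _ fun s => ?_)
        rw [Real.norm_eq_abs, abs_mul, abs_mul, abs_of_nonneg (gaussKernel_nonneg hδ.le _)]
        have hg0 : 0 ≤ gaussKernel δ (θ - s) := gaussKernel_nonneg hδ.le _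
        have h1 : |3 * (θ - s) / δ ^ 4 - (θ - s) ^ 3 / δ ^ 6| ≤ 3 * |θ - s| / δ ^ 4 + |θ - s| ^ 3 / δ ^ 6 := by
          calc |3 * (θ - s) / δ ^ 4 - (θ - s) ^ 3 / δ ^ 6| ≤ |3 * (θ - s) / δ ^ 4| + |(θ - s) ^ 3 / δ ^ 6| :=
                abs_sub _ _
            _ = 3 * |θ - s| / δ ^ 4 + |θ - s| ^ 3 / δ ^ 6 := by
                rw [abs_div, abs_div, abs_mul, abs_of_pos (by positivity : (0:ℝ) < δ ^ 4),
                  abs_of_pos (by positivity : (0:ℝ) < δ ^ 6), abs_of_pos (by norm_num : (0:ℝ) < 3), abs_pow]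
        calc |deriv tri s| * (|3 * (θ - s) / δ ^ 4 - (θ - s) ^ 3 / δ ^ 6| * gaussKernel δ (θ - s))
            ≤ 1 * ((3 * |θ - s| / δ ^ 4 + |θ - s| ^ 3 / δ ^ 6) * gaussKernel δ (θ - s)) :=
              mul_le_mul (abs_deriv_tri_le_one s) (mul_le_mul_of_nonneg_right h1 hg0) (by positivity) zero_le_one
          _ = _ := one_mul _
    _ = 10 / (δ ^ 3 * Real.sqrt (2 * Real.pi)) := hval

/-- `S_δ⁗ = tri′ ⋆ g_δ‴` as functions. [cite: Folland1999, §8.2 Prop. 8.10 (∂(f ∗ g) = f ∗ ∂g)] -/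
theorem deriv4_roundedSaw_eq {δ : ℝ} (hδ : 0 < δ) :
    deriv (deriv (deriv (deriv (roundedSaw δ)))) =
      fun x => ∫ s, deriv tri s * ((fun u => (3 * u / δ ^ 4 - u ^ 3 / δ ^ 6) * gaussKernel δ u) (x - s)) :=
  funext fun x => (hasDerivAt_deriv3_roundedSaw hδ x).deriv

/-- **`S_δ⁽⁵⁾ = tri′ ⋆ g_δ⁗`**: `S_δ⁗` is differentiable with derivative `∫ tri′(s) g_δ⁗(θ − s) ds`,
`g_δ⁗(u) = (3/δ⁴ − 6u²/δ⁶ + u⁴/δ⁸) g_δ(u)`. [cite: Folland1999, §8.2 Prop. 8.10 with Thm. 2.27 (differentiating a convolution)] -/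
theorem hasDerivAt_deriv4_roundedSaw {δ : ℝ} (hδ : 0 < δ) (θ : ℝ) :
    HasDerivAt (deriv (deriv (deriv (deriv (roundedSaw δ)))))
      (∫ s, deriv tri s * ((3 / δ ^ 4 - 6 * (θ - s) ^ 2 / δ ^ 6 + (θ - s) ^ 4 / δ ^ 8) * gaussKernel δ (θ - s))) θ := by
  rw [deriv4_roundedSaw_eq hδ]
  have hc : 0 < δ * Real.sqrt (2 * Real.pi) := by positivity
  have hK3c : Continuous (fun u : ℝ => (3 * u / δ ^ 4 - u ^ 3 / δ ^ 6) * gaussKernel δ u) :=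
    (((continuous_const.mul continuous_id).div_const _).sub ((continuous_pow 3).div_const _)).mul
      (continuous_gaussKernel δ)
  have hK4c : Continuous (fun u : ℝ => (3 / δ ^ 4 - 6 * u ^ 2 / δ ^ 6 + u ^ 4 / δ ^ 8) * gaussKernel δ u) :=
    ((continuous_const.sub ((continuous_const.mul (continuous_pow 2)).div_const _)).add
      ((continuous_pow 4).div_const _)).mul (continuous_gaussKernel δ)
  exact hasDerivAt_integral_deriv_tri_mul (hasDerivAt_gaussKernel_deriv3 δ) hK3c hK4c
    (integrable_gaussKernel_deriv3 hδ) (by positivity) (by positivity) (by positivity : (0:ℝ) < 1 / (2 * δ ^ 2)) 4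
    (abs_gaussKernel_deriv4_le hδ) θ

/-- **`|S_δ⁽⁵⁾(θ)| ≤ 12/δ⁴`** for every `θ` (`δ > 0`):
`|S_δ⁽⁵⁾| ≤ ∫|g_δ⁗| ≤ ∫ (3/δ⁴ + 6u²/δ⁶ + u⁴/δ⁸) g_δ = 3/δ⁴ + 6/δ⁴ + 3/δ⁴`.
[cite: Folland1999, §8.2 Prop. 8.8 (‖f ∗ g‖_u ≤ ‖f‖_∞ ‖g‖₁) and Prop. 8.10] -/
theorem abs_deriv5_roundedSaw_le {δ : ℝ} (hδ : 0 < δ) (θ : ℝ) :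
    |deriv (deriv (deriv (deriv (deriv (roundedSaw δ))))) θ| ≤ 12 / δ ^ 4 := by
  rw [(hasDerivAt_deriv4_roundedSaw hδ θ).deriv]
  have hBint : Integrable (fun s => (3 / δ ^ 4 + 6 * (θ - s) ^ 2 / δ ^ 6 + (θ - s) ^ 4 / δ ^ 8) * gaussKernel δ (θ - s)) := by
    have h := ((((integrable_gaussKernel hδ).const_mul (3 / δ ^ 4)).add
      (((integrable_pow_mul_gaussKernel hδ 2).div_const (δ ^ 6)).const_mul 6)).add
      ((integrable_pow_mul_gaussKernel hδ 4).div_const (δ ^ 8))).comp_sub_left θ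
    refine h.congr (ae_of_all _ fun s => ?_)
    simp only [Pi.add_apply]
    ring
  have hval : ∫ s, (3 / δ ^ 4 + 6 * (θ - s) ^ 2 / δ ^ 6 + (θ - s) ^ 4 / δ ^ 8) * gaussKernel δ (θ - s) = 12 / δ ^ 4 := by
    have hsub := integral_sub_left_eq_self
      (fun u => (3 / δ ^ 4 + 6 * u ^ 2 / δ ^ 6 + u ^ 4 / δ ^ 8) * gaussKernel δ u) volume θ
    rw [hsub]
    have i0 := (integrable_gaussKernel hδ).const_mul (3 / δ ^ 4)
    have i1 := ((integrable_pow_mul_gaussKernel hδ 2).div_const (δ ^ 6)).const_mul 6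
    have i2 := (integrable_pow_mul_gaussKernel hδ 4).div_const (δ ^ 8)
    have e : (fun u => (3 / δ ^ 4 + 6 * u ^ 2 / δ ^ 6 + u ^ 4 / δ ^ 8) * gaussKernel δ u) =
        fun u => 3 / δ ^ 4 * gaussKernel δ u + 6 * (u ^ 2 * gaussKernel δ u / δ ^ 6) +
          u ^ 4 * gaussKernel δ u / δ ^ 8 := by
      funext u; ring
    have i01 : Integrable (fun u => 3 / δ ^ 4 * gaussKernel δ u + 6 * (u ^ 2 * gaussKernel δ u / δ ^ 6)) := i0.add i1
    rw [e, integral_add i01 i2, integral_add i0 i1, integral_const_mul, integral_const_mul, integral_div,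
      integral_div, integral_gaussKernel hδ, integral_sq_mul_gaussKernel hδ, integral_pow_four_mul_gaussKernel hδ]
    field_simp
    ring
  calc |∫ s, deriv tri s * ((3 / δ ^ 4 - 6 * (θ - s) ^ 2 / δ ^ 6 + (θ - s) ^ 4 / δ ^ 8) * gaussKernel δ (θ - s))|
      ≤ ∫ s, (3 / δ ^ 4 + 6 * (θ - s) ^ 2 / δ ^ 6 + (θ - s) ^ 4 / δ ^ 8) * gaussKernel δ (θ - s) := by
        rw [← Real.norm_eq_abs]
        refine norm_integral_le_of_norm_le hBint (ae_of_all _ fun s => ?_)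
        rw [Real.norm_eq_abs, abs_mul, abs_mul, abs_of_nonneg (gaussKernel_nonneg hδ.le _)]
        have hg0 : 0 ≤ gaussKernel δ (θ - s) := gaussKernel_nonneg hδ.le _
        have h1 : |3 / δ ^ 4 - 6 * (θ - s) ^ 2 / δ ^ 6 + (θ - s) ^ 4 / δ ^ 8| ≤
            3 / δ ^ 4 + 6 * (θ - s) ^ 2 / δ ^ 6 + (θ - s) ^ 4 / δ ^ 8 := by
          calc |3 / δ ^ 4 - 6 * (θ - s) ^ 2 / δ ^ 6 + (θ - s) ^ 4 / δ ^ 8|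
              ≤ |3 / δ ^ 4 - 6 * (θ - s) ^ 2 / δ ^ 6| + |(θ - s) ^ 4 / δ ^ 8| := abs_add_le _ _
            _ ≤ (|3 / δ ^ 4| + |6 * (θ - s) ^ 2 / δ ^ 6|) + |(θ - s) ^ 4 / δ ^ 8| := by
                gcongr; exact abs_sub _ _
            _ = 3 / δ ^ 4 + 6 * (θ - s) ^ 2 / δ ^ 6 + (θ - s) ^ 4 / δ ^ 8 := by
                have h4 : 0 ≤ (θ - s) ^ 4 := by positivity
                rw [abs_of_pos (by positivity : (0:ℝ) < 3 / δ ^ 4),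
                  abs_of_nonneg (by positivity : (0:ℝ) ≤ 6 * (θ - s) ^ 2 / δ ^ 6),
                  abs_of_nonneg (by positivity : (0:ℝ) ≤ (θ - s) ^ 4 / δ ^ 8)]
        calc |deriv tri s| * (|3 / δ ^ 4 - 6 * (θ - s) ^ 2 / δ ^ 6 + (θ - s) ^ 4 / δ ^ 8| * gaussKernel δ (θ - s))
            ≤ 1 * ((3 / δ ^ 4 + 6 * (θ - s) ^ 2 / δ ^ 6 + (θ - s) ^ 4 / δ ^ 8) * gaussKernel δ (θ - s)) :=
              mul_le_mul (abs_deriv_tri_le_one s) (mul_le_mul_of_nonneg_right h1 hg0) (by positivity) zero_le_one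
          _ = _ := one_mul _
    _ = 12 / δ ^ 4 := hval

/-! ### §6 The cascade profile: `|U_j⁽ᵏ⁾| ≤ c_k (2πN_j)^{k−1}/δ_j^{k−1}`, `k = 3, 4, 5` -/

namespace CascadeParams

variable (P : CascadeParams)

/-- `U_j″ = 2πN_j · S_δ″(2πN_j ·)` as functions (`δ j > 0`, `N j ≠ 0`). [cite: ElgindiLissMattingly2025, §1 (H_α, V_α; here mollified and rescaled)] -/
theorem deriv2_U_eq {j : ℕ} (hδ : 0 < P.δ j) (hN : P.N j ≠ 0) :
    deriv (deriv (P.U j)) = fun y =>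
      deriv (deriv (roundedSaw (P.δ j))) (2 * Real.pi * P.N j * y) * (2 * Real.pi * P.N j) :=
  funext fun y => (P.hasDerivAt_deriv_U hδ hN y).deriv

/-- **Third derivative of the cascade profile**: `U_j‴(y) = (2πN_j)² S_δ‴(2πN_j y)` (`δ j > 0`, `N j ≠ 0`).
[cite: ElgindiLissMattingly2025, §1 (H_α, V_α; here mollified and rescaled)] -/
theorem hasDerivAt_deriv2_U {j : ℕ} (hδ : 0 < P.δ j) (hN : P.N j ≠ 0) (y : ℝ) :
    HasDerivAt (deriv (deriv (P.U j)))
      (deriv (deriv (deriv (roundedSaw (P.δ j)))) (2 * Real.pi * P.N j * y) * (2 * Real.pi * P.N j) *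
        (2 * Real.pi * P.N j)) y := by
  rw [P.deriv2_U_eq hδ hN]
  have h1 : HasDerivAt (fun y : ℝ => 2 * Real.pi * P.N j * y) (2 * Real.pi * P.N j) y := by
    simpa using (hasDerivAt_id y).const_mul (2 * Real.pi * (P.N j : ℝ))
  have h2 := (hasDerivAt_deriv2_roundedSaw hδ (2 * Real.pi * P.N j * y)).differentiableAt.hasDerivAt
  exact (h2.comp y h1).mul_const _

/-- `U_j‴ = (2πN_j)² S_δ‴(2πN_j ·)` as functions. [cite: ElgindiLissMattingly2025, §1 (H_α, V_α; here mollified and rescaled)] -/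
theorem deriv3_U_eq {j : ℕ} (hδ : 0 < P.δ j) (hN : P.N j ≠ 0) :
    deriv (deriv (deriv (P.U j))) = fun y =>
      deriv (deriv (deriv (roundedSaw (P.δ j)))) (2 * Real.pi * P.N j * y) * (2 * Real.pi * P.N j) *
        (2 * Real.pi * P.N j) :=
  funext fun y => (P.hasDerivAt_deriv2_U hδ hN y).deriv

/-- **Fourth derivative of the cascade profile**: `U_j⁗(y) = (2πN_j)³ S_δ⁗(2πN_j y)`.
[cite: ElgindiLissMattingly2025, §1 (H_α, V_α; here mollified and rescaled)] -/
theorem hasDerivAt_deriv3_U {j : ℕ} (hδ : 0 < P.δ j) (hN : P.N j ≠ 0) (y : ℝ) :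
    HasDerivAt (deriv (deriv (deriv (P.U j))))
      (deriv (deriv (deriv (deriv (roundedSaw (P.δ j))))) (2 * Real.pi * P.N j * y) * (2 * Real.pi * P.N j) *
        (2 * Real.pi * P.N j) * (2 * Real.pi * P.N j)) y := by
  rw [P.deriv3_U_eq hδ hN]
  have h1 : HasDerivAt (fun y : ℝ => 2 * Real.pi * P.N j * y) (2 * Real.pi * P.N j) y := by
    simpa using (hasDerivAt_id y).const_mul (2 * Real.pi * (P.N j : ℝ))
  have h2 := (hasDerivAt_deriv3_roundedSaw hδ (2 * Real.pi * P.N j * y)).differentiableAt.hasDerivAt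
  exact ((h2.comp y h1).mul_const _).mul_const _

/-- `U_j⁗ = (2πN_j)³ S_δ⁗(2πN_j ·)` as functions. [cite: ElgindiLissMattingly2025, §1 (H_α, V_α; here mollified and rescaled)] -/
theorem deriv4_U_eq {j : ℕ} (hδ : 0 < P.δ j) (hN : P.N j ≠ 0) :
    deriv (deriv (deriv (deriv (P.U j)))) = fun y =>
      deriv (deriv (deriv (deriv (roundedSaw (P.δ j))))) (2 * Real.pi * P.N j * y) * (2 * Real.pi * P.N j) *
        (2 * Real.pi * P.N j) * (2 * Real.pi * P.N j) :=
  funext fun y => (P.hasDerivAt_deriv3_U hδ hN y).deriv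

/-- **Fifth derivative of the cascade profile**: `U_j⁽⁵⁾(y) = (2πN_j)⁴ S_δ⁽⁵⁾(2πN_j y)`.
[cite: ElgindiLissMattingly2025, §1 (H_α, V_α; here mollified and rescaled)] -/
theorem hasDerivAt_deriv4_U {j : ℕ} (hδ : 0 < P.δ j) (hN : P.N j ≠ 0) (y : ℝ) :
    HasDerivAt (deriv (deriv (deriv (deriv (P.U j)))))
      (deriv (deriv (deriv (deriv (deriv (roundedSaw (P.δ j)))))) (2 * Real.pi * P.N j * y) * (2 * Real.pi * P.N j) *
        (2 * Real.pi * P.N j) * (2 * Real.pi * P.N j) * (2 * Real.pi * P.N j)) y := by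
  rw [P.deriv4_U_eq hδ hN]
  have h1 : HasDerivAt (fun y : ℝ => 2 * Real.pi * P.N j * y) (2 * Real.pi * P.N j) y := by
    simpa using (hasDerivAt_id y).const_mul (2 * Real.pi * (P.N j : ℝ))
  have h2 := (hasDerivAt_deriv4_roundedSaw hδ (2 * Real.pi * P.N j * y)).differentiableAt.hasDerivAt
  exact (((h2.comp y h1).mul_const _).mul_const _).mul_const _

/-- **Third-derivative cap of the cascade profile**: `|U_j‴(y)| ≤ 2 (2πN_j)²/δ_j²` for every `y`
(`δ j > 0`; for `N_j = 0` the profile is constant). [cite: ElgindiLissMattingly2025, §1 and Rmk. 1.4 (the smoothed pulse profiles)] -/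
theorem abs_deriv3_U_le {j : ℕ} (hδ : 0 < P.δ j) (y : ℝ) :
    |deriv (deriv (deriv (P.U j))) y| ≤ 2 * (2 * Real.pi * P.N j) ^ 2 / P.δ j ^ 2 := by
  rcases eq_or_ne (P.N j) 0 with hN | hN
  · have hfun : P.U j = fun _ => 0 := by
      funext y
      simp [CascadeParams.U, hN]
    rw [hfun]
    simp [hN]
  · rw [(P.hasDerivAt_deriv2_U hδ hN y).deriv, abs_mul, abs_mul]
    have hc : 0 < 2 * Real.pi * (P.N j : ℝ) := by
      have : (0 : ℝ) < P.N j := by exact_mod_cast Nat.pos_of_ne_zero hN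
      positivity
    rw [abs_of_pos hc]
    have h := abs_deriv3_roundedSaw_le hδ (2 * Real.pi * P.N j * y)
    calc |deriv (deriv (deriv (roundedSaw (P.δ j)))) (2 * Real.pi * P.N j * y)| * (2 * Real.pi * P.N j) *
          (2 * Real.pi * P.N j)
        ≤ 2 / P.δ j ^ 2 * (2 * Real.pi * P.N j) * (2 * Real.pi * P.N j) := by gcongr
      _ = 2 * (2 * Real.pi * P.N j) ^ 2 / P.δ j ^ 2 := by ring

/-- **Fourth-derivative cap of the cascade profile**: `|U_j⁗(y)| ≤ 10 (2πN_j)³/(δ_j³ √(2π))`.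
[cite: ElgindiLissMattingly2025, §1 and Rmk. 1.4 (the smoothed pulse profiles)] -/
theorem abs_deriv4_U_le {j : ℕ} (hδ : 0 < P.δ j) (y : ℝ) :
    |deriv (deriv (deriv (deriv (P.U j)))) y| ≤
      10 * (2 * Real.pi * P.N j) ^ 3 / (P.δ j ^ 3 * Real.sqrt (2 * Real.pi)) := by
  rcases eq_or_ne (P.N j) 0 with hN | hN
  · have hfun : P.U j = fun _ => 0 := by
      funext y
      simp [CascadeParams.U, hN]
    rw [hfun]
    simp [hN]
  · rw [(P.hasDerivAt_deriv3_U hδ hN y).deriv, abs_mul, abs_mul, abs_mul]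
    have hc : 0 < 2 * Real.pi * (P.N j : ℝ) := by
      have : (0 : ℝ) < P.N j := by exact_mod_cast Nat.pos_of_ne_zero hN
      positivity
    rw [abs_of_pos hc]
    have h := abs_deriv4_roundedSaw_le hδ (2 * Real.pi * P.N j * y)
    have hs : 0 < P.δ j ^ 3 * Real.sqrt (2 * Real.pi) := by positivity
    calc |deriv (deriv (deriv (deriv (roundedSaw (P.δ j))))) (2 * Real.pi * P.N j * y)| * (2 * Real.pi * P.N j) *
          (2 * Real.pi * P.N j) * (2 * Real.pi * P.N j)
        ≤ 10 / (P.δ j ^ 3 * Real.sqrt (2 * Real.pi)) * (2 * Real.pi * P.N j) * (2 * Real.pi * P.N j) *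
            (2 * Real.pi * P.N j) := by gcongr
      _ = 10 * (2 * Real.pi * P.N j) ^ 3 / (P.δ j ^ 3 * Real.sqrt (2 * Real.pi)) := by
          field_simp

/-- **Fifth-derivative cap of the cascade profile**: `|U_j⁽⁵⁾(y)| ≤ 12 (2πN_j)⁴/δ_j⁴`.
[cite: ElgindiLissMattingly2025, §1 and Rmk. 1.4 (the smoothed pulse profiles)] -/
theorem abs_deriv5_U_le {j : ℕ} (hδ : 0 < P.δ j) (y : ℝ) :
    |deriv (deriv (deriv (deriv (deriv (P.U j))))) y| ≤ 12 * (2 * Real.pi * P.N j) ^ 4 / P.δ j ^ 4 := by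
  rcases eq_or_ne (P.N j) 0 with hN | hN
  · have hfun : P.U j = fun _ => 0 := by
      funext y
      simp [CascadeParams.U, hN]
    rw [hfun]
    simp [hN]
  · rw [(P.hasDerivAt_deriv4_U hδ hN y).deriv, abs_mul, abs_mul, abs_mul, abs_mul]
    have hc : 0 < 2 * Real.pi * (P.N j : ℝ) := by
      have : (0 : ℝ) < P.N j := by exact_mod_cast Nat.pos_of_ne_zero hN
      positivity
    rw [abs_of_pos hc]
    have h := abs_deriv5_roundedSaw_le hδ (2 * Real.pi * P.N j * y)
    calc |deriv (deriv (deriv (deriv (deriv (roundedSaw (P.δ j)))))) (2 * Real.pi * P.N j * y)| *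
          (2 * Real.pi * P.N j) * (2 * Real.pi * P.N j) * (2 * Real.pi * P.N j) * (2 * Real.pi * P.N j)
        ≤ 12 / P.δ j ^ 4 * (2 * Real.pi * P.N j) * (2 * Real.pi * P.N j) * (2 * Real.pi * P.N j) *
            (2 * Real.pi * P.N j) := by gcongr
      _ = 12 * (2 * Real.pi * P.N j) ^ 4 / P.δ j ^ 4 := by ring

end CascadeParams

end Literature.Analysis.FluidPDE.SawtoothCascade

end
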